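/-
Copyright (c) 2026 the pub-hodgecm-mathlib formalisation cell (harness21).  Prover seat hodgecm-mathlib-F0P3a-p01 (g23), 2026-09-03.  E1 row 48 «(SS-O) ELLIPTIC UNFOLDING ASSEMBLY»
(E1 keeper ∕ dealer F0P3a-p03 (g29) 02:26:58Z; census `F0/P3a/F0P3a-p01/g23/r48/CENSUS-R48-SSO-elliptic-unfolding.v1.F0P3ap01g23.md`).
-/
import Literature.NumberTheory.Automorphic.SmoothCharacterCosetTrace          -- ★ TRACE-COSET: `levelTrace_eq_trace_restrict_of_mem_normalizer`, `apply_mem_fixedPoints_of_mem_normalizer`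
import Literature.NumberTheory.Automorphic.SmoothFixedVectorGeneration       -- ★ row 23: `mem_fixedPoints_map_conj_iff`, `apply_inv_mem_fixedPoints_iff`
import Mathlib.RepresentationTheory.Character                                 -- `Representation.character`
import HarnessLib

/-!
# The value of a `K`-type function `𝟙_P · χ_τ(·⁻¹)` along an orbit: `f(g⁻¹ γ g) = tr(π(γ⁻¹) | V^{U_{g·x₀}})` at a `γ`-fixed point `g·x₀` (Schneider–Stuhler 1997 §III.4; Kottwitz 1988 §2)

Topic `NumberTheory/Automorphic`; namespace `Representation` (dot notation on `ρ`, as in ★ `SmoothCharacter` ∕ ★ `SmoothCharacterEPFunctionTrace`).  THEOREMS ONLY (no definition,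
no instance, no notation, no named fact, no `sorry`).  Cell `pub/hodgecm-mathlib` (D-0151), crux H413 = `stmt-HodgeConjecture-24833`; E1 row 48 «(SS-O) ELLIPTIC UNFOLDING ASSEMBLY»,
§1 = the census' FIRST MISSING LEMMA (A3): the VALUE LAW that feeds ★ `OrbitalIntegralFixedPointWeightedAction.classOrbitalIntegral_eq_smul_finsum_fixedPoints_of_vertexAction`
(`hval : act γ (act g x₀) = act g x₀ → φ (g⁻¹ * γ * g) = val (act g x₀)`) for the summands `f_i = 𝟙_{P_i} · χ_{τ_i}(·⁻¹)` of the Euler–Poincaré function `f_EP^{V,e}` (★ row 42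
`SmoothCharacterEPFunctionTrace` letters `hfP`∕`hf0`).  HONEST LABEL: count-neutral generic base layer ((R-SS) not chartered; E1 = PRINT until the charter test); HC_CM is proved only
modulo the 2 remaining named inputs (hLiu418 24832, h413 24833) until rung 0 closes; nothing printed is asserted here.

THE MATHEMATICS.  `G` acts on a set `W` (`act`, with `act 1 = id`, `act (gh) = act g ∘ act h`); `x₀ ∈ W` with stabiliser `P` (`g ∈ P ↔ g·x₀ = x₀`); a family of compact open
subgroups `U : W → Subgroup G` transported by the action (`U (g·x) = g (U x) g⁻¹`) with `P ≤ N_G(U x₀)`; `ρ` a representation of `G` on `V`; `τ` = THE RESTRICTION of `ρ` to `P` on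
`V^{U x₀}` (hypothesis-style: `τ : Representation ℂ P (V^{U x₀})` with `(τ p w : V) = ρ p w`), `f : G → ℂ` with `f p = χ_τ(p⁻¹)` on `P`.  If `γ` FIXES `g·x₀` then `g⁻¹γg ∈ P` and
  `f (g⁻¹ γ g) = tr(τ(g⁻¹ γ⁻¹ g)) = tr(ρ(g⁻¹γ⁻¹g) | V^{U x₀}) = tr(ρ(γ⁻¹) | V^{U (g·x₀)}) = Θ_{U (g·x₀)}(γ⁻¹)`,
the third step by transport of structure along `ρ(g) : V^{U x₀} ≃ V^{U (g·x₀)}` (★ row 23), the last by ★ TRACE-COSET (`γ⁻¹` normalises `U (g·x₀)`).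

* §1 `conj_mem_stabilizer_of_fix` (`γ·(g·x₀) = g·x₀ ⇒ g⁻¹γg ∈ P`), `mem_normalizer_map_conj_of_mem_normalizer` (transport of normalisers),
  `trace_restrict_fixedPoints_map_conj` (`tr(ρ(γ)|V^{gKg⁻¹}) = tr(ρ(g⁻¹γg)|V^K)`), **`levelTrace_map_conj`** (`Θ_{gKg⁻¹}(γ) = Θ_K(g⁻¹γg)` for `g⁻¹γg ∈ N(K)`),
  `levelTrace_congr_of_eq`, **`kType_conj_apply_eq_levelTrace_inv`** (the value law); §2 `isLocallyConstant_of_kType`, `continuous_of_kType` (the `Continuous φ` binder of ★ (A2)).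

## References
* [SchneiderStuhler1997] P. Schneider, U. Stuhler, *Representation theory and sheaves on the Bruhat–Tits building*, Publ. Math. IHÉS 85 (1997), §III.4 (Euler–Poincaré functions,
  their orbital integrals on the elliptic set).
* [Kottwitz1988] R. E. Kottwitz, *Tamagawa numbers*, Ann. of Math. 127 (1988), §2 (the case `V = 𝟙`).
* [Rogawski1990] J. D. Rogawski, *Automorphic Representations of Unitary Groups in Three Variables*, Ann. of Math. Stud. 123 (1990), §4.9 p. 54 (orbital integrals unfolded
  over fixed cosets).
-/

set_option autoImplicit false

open scoped Pointwise

namespace Representation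

variable {G : Type*} [Group G] [TopologicalSpace G] [IsTopologicalGroup G]
  {V : Type*} [AddCommGroup V] [Module ℂ V] (ρ : Representation ℂ G V)

/-! ## §1 The value law -/

omit [TopologicalSpace G] [IsTopologicalGroup G] in
/-- If `γ` fixes `g·x₀` then `g⁻¹γg` fixes `x₀`, i.e. lies in the stabiliser `P`. [cite: Rogawski1990, §4.9 p. 54] [cite: Kottwitz1988, §2] -/
theorem conj_mem_stabilizer_of_fix {W : Type*} (act : G → W → W) (act_one : ∀ x : W, act 1 x = x) (act_mul : ∀ (g h : G) (x : W), act (g * h) x = act g (act h x))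
    (x₀ : W) {P : Subgroup G} (hP : ∀ g : G, g ∈ P ↔ act g x₀ = x₀) {γ g : G} (hfix : act γ (act g x₀) = act g x₀) : g⁻¹ * γ * g ∈ P := by
  rw [hP, act_mul, act_mul, hfix, ← act_mul, inv_mul_cancel, act_one]

omit [TopologicalSpace G] [IsTopologicalGroup G] in
/-- Transport of normalisers: `h ∈ N(K) ⇒ g h g⁻¹ ∈ N(g K g⁻¹)`. [cite: Kottwitz1988, §2] -/
theorem mem_normalizer_map_conj_of_mem_normalizer (K : Subgroup G) (g : G) {h : G} (hh : h ∈ Subgroup.normalizer (K : Set G)) :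
    g * h * g⁻¹ ∈ Subgroup.normalizer ((K.map (MulAut.conj g).toMonoidHom : Subgroup G) : Set G) := by
  have hmap := Subgroup.map_equiv_normalizer_eq K (MulAut.conj g)
  have hmem : g * h * g⁻¹ ∈ (Subgroup.normalizer (K : Set G)).map (MulAut.conj g).toMonoidHom :=
    ⟨h, hh, by rw [MulEquiv.coe_toMonoidHom, MulAut.conj_apply]⟩
  rw [hmap] at hmem
  exact hmem

omit [TopologicalSpace G] [IsTopologicalGroup G] in
/-- **Transport of the restricted trace**: for `g⁻¹γg ∈ N(K)` (so that `γ ∈ N(gKg⁻¹)`), `tr(ρ(γ) | V^{gKg⁻¹}) = tr(ρ(g⁻¹γg) | V^K)` — conjugate by `ρ(g) : V^K ≃ V^{gKg⁻¹}` (★ row 23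
`mem_fixedPoints_map_conj_iff` ∕ `apply_inv_mem_fixedPoints_iff`) and use `LinearMap.trace_conj'`. [cite: SchneiderStuhler1997, §III.4] [cite: Kottwitz1988, §2] -/
theorem trace_restrict_fixedPoints_map_conj (K : Subgroup G) (g γ : G) (hγ : g⁻¹ * γ * g ∈ Subgroup.normalizer (K : Set G))
    (hγ' : γ ∈ Subgroup.normalizer ((K.map (MulAut.conj g).toMonoidHom : Subgroup G) : Set G)) :
    LinearMap.trace ℂ (ρ.fixedPoints (K.map (MulAut.conj g).toMonoidHom))
        ((ρ γ).restrict (ρ.apply_mem_fixedPoints_of_mem_normalizer hγ')) =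
      LinearMap.trace ℂ (ρ.fixedPoints K) ((ρ (g⁻¹ * γ * g)).restrict (ρ.apply_mem_fixedPoints_of_mem_normalizer hγ)) := by
  -- the transport equivalence `e : V^K ≃ V^{gKg⁻¹}`, `w ↦ ρ g w`
  let e : ρ.fixedPoints K ≃ₗ[ℂ] ρ.fixedPoints (K.map (MulAut.conj g).toMonoidHom) :=
    { toFun := fun w => ⟨ρ g w, (ρ.mem_fixedPoints_map_conj_iff K g w).2 w.2⟩
      map_add' := fun v w => by apply Subtype.ext; exact map_add (ρ g) (v : V) (w : V)
      map_smul' := fun c w => by apply Subtype.ext; exact map_smul (ρ g) c (w : V)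
      invFun := fun w => ⟨ρ g⁻¹ w, (ρ.apply_inv_mem_fixedPoints_iff K g w).2 w.2⟩
      left_inv := fun w => by
        apply Subtype.ext
        change ρ g⁻¹ (ρ g w) = w
        rw [← Module.End.mul_apply, ← map_mul, inv_mul_cancel, map_one, Module.End.one_apply]
      right_inv := fun w => by
        apply Subtype.ext
        change ρ g (ρ g⁻¹ w) = w
        rw [← Module.End.mul_apply, ← map_mul, mul_inv_cancel, map_one, Module.End.one_apply] }
  have hconj : (ρ γ).restrict (ρ.apply_mem_fixedPoints_of_mem_normalizer hγ') =
      e.conj ((ρ (g⁻¹ * γ * g)).restrict (ρ.apply_mem_fixedPoints_of_mem_normalizer hγ)) := by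
    apply LinearMap.ext
    intro w
    apply Subtype.ext
    rw [LinearEquiv.conj_apply, LinearMap.coe_comp, LinearMap.coe_comp, Function.comp_apply, Function.comp_apply, LinearMap.coe_restrict_apply]
    change ρ γ (w : V) = ρ g (ρ (g⁻¹ * γ * g) (ρ g⁻¹ (w : V)))
    rw [← Module.End.mul_apply, ← map_mul, ← Module.End.mul_apply, ← map_mul]
    congr 2
    group
  rw [hconj, LinearMap.trace_conj']

/-- **`Θ_{gKg⁻¹}(γ) = Θ_K(g⁻¹γg)`** for `g⁻¹γg ∈ N(K)` (the level trace ★ `levelTrace` of ★ `SmoothCharacter`; ★ TRACE-COSET reads both sides as restricted traces).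
[cite: SchneiderStuhler1997, §III.4] [cite: Kottwitz1988, §2] -/
theorem levelTrace_map_conj {K : Subgroup G} (hKo : IsOpen (K : Set G)) (hKc : IsCompact (K : Set G)) (g γ : G)
    (hγ : g⁻¹ * γ * g ∈ Subgroup.normalizer (K : Set G))
    (hKo' : IsOpen ((K.map (MulAut.conj g).toMonoidHom : Subgroup G) : Set G)) (hKc' : IsCompact ((K.map (MulAut.conj g).toMonoidHom : Subgroup G) : Set G)) :
    ρ.levelTrace hKo' hKc' γ = ρ.levelTrace hKo hKc (g⁻¹ * γ * g) := by
  have hγ' : γ ∈ Subgroup.normalizer ((K.map (MulAut.conj g).toMonoidHom : Subgroup G) : Set G) := by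
    have := mem_normalizer_map_conj_of_mem_normalizer K g hγ
    rwa [show g * (g⁻¹ * γ * g) * g⁻¹ = γ by group] at this
  rw [ρ.levelTrace_eq_trace_restrict_of_mem_normalizer hKo' hKc' hγ', ρ.levelTrace_eq_trace_restrict_of_mem_normalizer hKo hKc hγ,
    ρ.trace_restrict_fixedPoints_map_conj K g γ hγ hγ']

/-- Bookkeeping: the level trace only depends on the subgroup, not on the openness ∕ compactness witnesses (for rewriting `U (g·x₀) = g (U x₀) g⁻¹`). [cite: Kottwitz1988, §2] -/
theorem levelTrace_congr_of_eq {K₁ K₂ : Subgroup G} (h : K₁ = K₂) (h1o : IsOpen (K₁ : Set G)) (h1c : IsCompact (K₁ : Set G)) (h2o : IsOpen (K₂ : Set G))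
    (h2c : IsCompact (K₂ : Set G)) (γ : G) : ρ.levelTrace h1o h1c γ = ρ.levelTrace h2o h2c γ := by
  subst h
  rfl

/-- **THE VALUE LAW OF A `K`-TYPE FUNCTION ALONG AN ORBIT**: for `f = 𝟙_P · χ_τ(·⁻¹)` with `τ` the restriction of `ρ` to the stabiliser `P` of `x₀` acting on `V^{U x₀}`, a level family
transported by the action (`U (g·x) = g (U x) g⁻¹`) with `P ≤ N(U x₀)`, and a point `g·x₀` FIXED by `γ`:  `f (g⁻¹ γ g) = Θ_{U (g·x₀)}(γ⁻¹) = tr(ρ(γ⁻¹) | V^{U (g·x₀)})`.  This is the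
binder `hval` of ★ `classOrbitalIntegral_eq_smul_finsum_fixedPoints_of_vertexAction` for the summands of the Euler–Poincaré function `f_EP^{V,e}` (★ row 42 letters `hfP`).
[cite: SchneiderStuhler1997, §III.4] [cite: Kottwitz1988, §2] [cite: Rogawski1990, §4.9 p. 54] -/
theorem kType_conj_apply_eq_levelTrace_inv {W : Type*} (act : G → W → W) (act_one : ∀ x : W, act 1 x = x) (act_mul : ∀ (g h : G) (x : W), act (g * h) x = act g (act h x))
    (x₀ : W) (U : W → Subgroup G) (hUo : ∀ x, IsOpen (U x : Set G)) (hUc : ∀ x, IsCompact (U x : Set G))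
    (hUg : ∀ (g : G) (x : W), U (act g x) = (U x).map (MulAut.conj g).toMonoidHom)
    {P : Subgroup G} (hP : ∀ g : G, g ∈ P ↔ act g x₀ = x₀) (hPU : P ≤ Subgroup.normalizer (U x₀ : Set G))
    (τ : Representation ℂ ↥P ↥(ρ.fixedPoints (U x₀))) (hτρ : ∀ (p : ↥P) (w : ↥(ρ.fixedPoints (U x₀))), ((τ p w : ↥(ρ.fixedPoints (U x₀))) : V) = ρ (p : G) (w : V))
    [FiniteDimensional ℂ ↥(ρ.fixedPoints (U x₀))]
    {f : G → ℂ} (hfP : ∀ (g : G) (hg : g ∈ P), f g = Representation.character τ ⟨g, hg⟩⁻¹)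
    {γ g : G} (hfix : act γ (act g x₀) = act g x₀) :
    f (g⁻¹ * γ * g) = ρ.levelTrace (hUo (act g x₀)) (hUc (act g x₀)) γ⁻¹ := by
  have hmem : g⁻¹ * γ * g ∈ P := conj_mem_stabilizer_of_fix act act_one act_mul x₀ hP hfix
  have hmem' : g⁻¹ * γ⁻¹ * g ∈ P := by
    have := P.inv_mem hmem
    rwa [show (g⁻¹ * γ * g)⁻¹ = g⁻¹ * γ⁻¹ * g by group] at this
  have hN : g⁻¹ * γ⁻¹ * g ∈ Subgroup.normalizer (U x₀ : Set G) := hPU hmem'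
  -- the left-hand side is the trace of `τ` at `(g⁻¹γg)⁻¹ = g⁻¹γ⁻¹g`, i.e. of `ρ(g⁻¹γ⁻¹g)` restricted to `V^{U x₀}`
  have hinv : (⟨g⁻¹ * γ * g, hmem⟩ : P)⁻¹ = ⟨g⁻¹ * γ⁻¹ * g, hmem'⟩ := by
    apply Subtype.ext
    change (g⁻¹ * γ * g)⁻¹ = g⁻¹ * γ⁻¹ * g
    group
  have hτ : τ ⟨g⁻¹ * γ⁻¹ * g, hmem'⟩ = (ρ (g⁻¹ * γ⁻¹ * g)).restrict (ρ.apply_mem_fixedPoints_of_mem_normalizer hN) := by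
    apply LinearMap.ext
    intro w
    apply Subtype.ext
    rw [LinearMap.coe_restrict_apply]
    exact hτρ _ w
  rw [hfP _ hmem, hinv]
  change LinearMap.trace ℂ _ (τ ⟨g⁻¹ * γ⁻¹ * g, hmem'⟩) = _
  rw [hτ]
  -- the right-hand side, transported back to `x₀`
  have hK : U (act g x₀) = (U x₀).map (MulAut.conj g).toMonoidHom := hUg g x₀
  have hKo' : IsOpen (((U x₀).map (MulAut.conj g).toMonoidHom : Subgroup G) : Set G) := by rw [← hK]; exact hUo _
  have hKc' : IsCompact (((U x₀).map (MulAut.conj g).toMonoidHom : Subgroup G) : Set G) := by rw [← hK]; exact hUc _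
  rw [ρ.levelTrace_congr_of_eq hK (hUo _) (hUc _) hKo' hKc', ρ.levelTrace_map_conj (hUo x₀) (hUc x₀) g γ⁻¹ hN hKo' hKc',
    ρ.levelTrace_eq_trace_restrict_of_mem_normalizer (hUo x₀) (hUc x₀) hN]


/-! ## §2 A `K`-type function is locally constant -/

/-- **`f = 𝟙_P · χ_τ(·⁻¹)` IS LOCALLY CONSTANT** (hence continuous) when `τ` is trivial on an OPEN subgroup `U ≤ P`: on the coset `x·U` of `x ∈ P`, `χ_τ((xu)⁻¹) = tr(τ(u⁻¹)τ(x⁻¹)) = χ_τ(x⁻¹)`;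
off `P` the coset `x·U` misses `P` and `f` vanishes on it (★ row 42 letters `hτ`∕`hfP`∕`hf0`). [cite: SchneiderStuhler1997, §III.4] [cite: Kottwitz1988, §2] -/
theorem isLocallyConstant_of_kType {U P : Subgroup G} (hUo : IsOpen (U : Set G)) (hUP : U ≤ P)
    {W : Type*} [AddCommGroup W] [Module ℂ W] [FiniteDimensional ℂ W] (τ : Representation ℂ ↥P W) (hτ : ∀ (u : G) (hu : u ∈ U), τ ⟨u, hUP hu⟩ = 1)
    {f : G → ℂ} (hfP : ∀ (g : G) (hg : g ∈ P), f g = Representation.character τ ⟨g, hg⟩⁻¹) (hf0 : ∀ g ∉ P, f g = 0) : IsLocallyConstant f := by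
  rw [IsLocallyConstant.iff_exists_open]
  intro x
  refine ⟨x • (U : Set G), hUo.smul x, ⟨1, U.one_mem, by simp⟩, fun x' hx' => ?_⟩
  obtain ⟨u, hu, rfl⟩ := Set.mem_smul_set.1 hx'
  change f (x * u) = f x
  by_cases hx : x ∈ P
  · have hxu : x * u ∈ P := P.mul_mem hx (hUP hu)
    rw [hfP _ hxu, hfP _ hx]
    have hu1 : τ (⟨u, hUP hu⟩ : ↥P)⁻¹ = 1 := by
      have h := hτ u hu
      have : τ ((⟨u, hUP hu⟩ : ↥P)⁻¹ * ⟨u, hUP hu⟩) = 1 := by rw [inv_mul_cancel, map_one]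
      rwa [map_mul, h, mul_one] at this
    have hsplit : (⟨x * u, hxu⟩ : ↥P)⁻¹ = (⟨u, hUP hu⟩ : ↥P)⁻¹ * (⟨x, hx⟩ : ↥P)⁻¹ := by
      rw [← mul_inv_rev]; rfl
    unfold Representation.character
    rw [hsplit, map_mul, hu1, one_mul]
  · have hxu : x * u ∉ P := fun h => hx (by simpa using P.mul_mem h (P.inv_mem (hUP hu)))
    rw [hf0 _ hxu, hf0 _ hx]

/-- **`f = 𝟙_P · χ_τ(·⁻¹)` is continuous** (locally constant). [cite: SchneiderStuhler1997, §III.4] [cite: Kottwitz1988, §2] -/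
theorem continuous_of_kType {U P : Subgroup G} (hUo : IsOpen (U : Set G)) (hUP : U ≤ P)
    {W : Type*} [AddCommGroup W] [Module ℂ W] [FiniteDimensional ℂ W] (τ : Representation ℂ ↥P W) (hτ : ∀ (u : G) (hu : u ∈ U), τ ⟨u, hUP hu⟩ = 1)
    {f : G → ℂ} (hfP : ∀ (g : G) (hg : g ∈ P), f g = Representation.character τ ⟨g, hg⟩⁻¹) (hf0 : ∀ g ∉ P, f g = 0) : Continuous f :=
  (isLocallyConstant_of_kType hUo hUP τ hτ hfP hf0).continuous

end Representation
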